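import Literature.NumberTheory.EllipticCurves.ProfiniteGroupDistributionGlueIntegral
import Literature.NumberTheory.EllipticCurves.ProfiniteGroupDistributionInduction
import HarnessLib

set_option autoImplicit false

/-!
# De Shalit II.4.14 (38), first line, as an IDENTITY: the integral of a multiplicative character against the glued
# two-variable measure is `(χ(σ_𝔠) − N𝔠)⁻¹ ·` the coset sum of the inner integrals of the induced cell measures;
# and the indicator-weighted comparison of two integrands that agree on `U₀` (the measure half of (38), second line)

Topic `NumberTheory/EllipticCurves`; namespace `Literature.NumberTheory.EllipticCurves` (sequel of
`ProfiniteGroupDistributionGlueIntegral.lean` — `integral_glue_eq`, of `ProfiniteGroupDistributionTwoVariableAssembly.lean` —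
`integral_eq_of_glue`, and of `ProfiniteGroupDistributionInduction.lean` — `induce`, `integral_induce`).  Typed generically for the
BSD cell `bsd-print-cf2` (typer `bsd-print-cf2-ty2` g45; port P59 of STUB-PLAN `stub_heegnerIndexLowerAtTwo`, construction-lane
currency of crux `PrintCf2.SplitBadTwoLowerHalfOfFacts` / stmt-BirchSwinnertonDyer-24721; sketch k3-g43 `4443183570b74d89` §1, §3, §4
VERBATIM).  Everything is PROVED; no definition, no named fact, no `sorry`; BSD, the crux and the stub are untouched.

De Shalit, *Iwasawa theory of elliptic curves with complex multiplication* (1987), II.4.14 (p. 72), proof of Theorem II.4.12,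
Step 2: "(38) `∫ χ dμ ≡ (χ(σ_𝔠) − N𝔠)⁻¹ Σ_{c} χ(r_c) ∫_{U₀} χ dμ_M(r_c⁻¹ β_M 𝔠) ≡ … mod p^m` […] Since `m` may be arbitrarily
large, the two sides of (36) are in fact equal."  Here the first congruence is an EQUALITY at every modulus `M` (de Shalit
writes `≡` only because he localises `χφ̄^j` at the same time), by (29)↔(31) of II.4.12 and II.4.7 (16) line 1 chained —
in the tree: `integral_eq_of_glue` ▸ `integral_glue_eq` ▸ `integral_induce`.

* §1 `eq_of_forall_norm_sub_le` — the limit glue: `‖x − y‖ ≤ C·p^{−M}` for every `M` forces `x = y` in `ℂ_p`.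
* §2 ★ `integral_eq_cosetSum_of_glue_induce`, ★ `integral_eq_cosetSum_mul_of_glue_induce` — (38) line 1 as an identity.
* §3 `norm_integral_indicator_mul_sub_le` — (38) line 2, measure half: integrands agreeing to within `η` on `U₀` have
  `𝟙_{U₀}`-weighted integrals agreeing to within `‖D‖·η`.
-/

noncomputable section

open Filter
open scoped Topology Classical

namespace Literature.NumberTheory.EllipticCurves

/-! ### §1. The limit glue: a congruence modulo every `p^M` is an equality -/

/-- **"Since `m` may be arbitrarily large, the two sides of (36) are in fact equal"** (de Shalit p. 72):
in `ℂ_p`, `‖x − y‖ ≤ C·p^{−M}` for every `M` forces `x = y`. [cite: deShalit1987, II.4.14 Step 2 (p. 72)] -/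
theorem eq_of_forall_norm_sub_le {p : ℕ} [hp : Fact p.Prime] {x y : ℂ_[p]} {C : ℝ}
    (h : ∀ M : ℕ, ‖x - y‖ ≤ C * ((p : ℝ)⁻¹) ^ M) : x = y := by
  have hp1 : 1 < (p : ℝ) := by exact_mod_cast hp.out.one_lt
  have h0 : Tendsto (fun M : ℕ ↦ C * ((p : ℝ)⁻¹) ^ M) atTop (𝓝 (C * 0)) :=
    tendsto_const_nhds.mul (tendsto_pow_atTop_nhds_zero_of_lt_one (inv_nonneg.mpr (by positivity))
      (inv_lt_one_of_one_lt₀ hp1))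
  rw [mul_zero] at h0
  have hle : ‖x - y‖ ≤ 0 := ge_of_tendsto' h0 h
  exact sub_eq_zero.mp (norm_le_zero_iff.mp hle)

/-! ### §2. «Coset reduction» — de Shalit (38) line 1 is an IDENTITY for the glued induced measure -/

section CosetReduction

open GroupDistribution

variable {p : ℕ} [Fact p.Prime]
variable {G : Type*} [Group G] {𝒰 : ℕ → SubgroupTower G}
  {href : ∀ m n, (𝒰 (m + 1)).U n ≤ (𝒰 m).U n} [∀ m n, ((𝒰 m).U n).Normal]
variable {B : ℕ → Type*} [∀ m, CommMonoid (B m)] [∀ m, MulDistribMulAction G (B m)] {I : Type*}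

/-- ★ **Coset reduction (de Shalit (38) line 1, generic).** Let `D_M : B_M → Λ(G along 𝒰^{(M)})` be the cell measures of the
`M`-th modulus with common bound `C`, `i_M = induce D_M` (II.4.6), and `E` the glued two-variable
measure with `δ_{σ_𝔠,N𝔠} E = i_n(β_n 𝔠)` levelwise, the `i_M(β_M 𝔠)` compatible under coarsening
(`exists_glue_twisting_μ_eq_forall_seriesFamily`).  Then for EVERY multiplicative `χ : G → ℂ_p`,
tower-continuous for `𝒰^{(M)}`, with `χ(σ_𝔠) ≠ N𝔠`:
`∫_G χ dE = (χ(σ_𝔠) − N𝔠)⁻¹ · Σ_{c ∈ G/U₀^{(M)}} ∫ 𝟙_{U₀^{(M)}}(y)·χ(r_c y) dD_M(r_c⁻¹•β_M 𝔠)(y)` —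
(29)↔(31), II.4.14 Step 1 and II.4.7 (16) line 1 chained; EXACT at every modulus (de Shalit writes
`≡ mod p^m` in (38) only because he localises `χφ̄^j` at the same time).
[cite: deShalit1987, II.4.14 (38) (p. 72), II.4.12 (29)–(31) (p. 67–69), II.4.7 (16) (p. 60)] -/
theorem integral_eq_cosetSum_of_glue_induce
    (D : (m : ℕ) → B m → GroupDistribution (𝒰 m) ℂ_[p]) {C : ℝ} (hC0 : 0 ≤ C)
    (hCb : ∀ (m : ℕ) (b : B m), (D m b).bound ≤ C)
    (β : (m : ℕ) → I → B m) (σ : I → G) (Nm : I → ℕ)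
    (E : GroupDistribution (SubgroupTower.diagonal 𝒰 href) ℂ_[p]) (c : I)
    (hE : ∀ (n : ℕ) (b : G ⧸ (𝒰 n).U n),
      (twisting (σ c) (Nm c : ℂ_[p]) E).μ n b = (induce (D n) hC0 (hCb n) (β n c)).μ n b)
    (hcompat : ∀ (m n : ℕ) (a : G ⧸ (𝒰 m).U n),
      ((induce (D (m + 1)) hC0 (hCb (m + 1)) (β (m + 1) c)).pushforward (MonoidHom.id G)
        (SubgroupTower.le_comap_id 𝒰 href m)).μ n a = (induce (D m) hC0 (hCb m) (β m c)).μ n a)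
    (M : ℕ) {χ : G → ℂ_[p]} (hχc : (𝒰 M).IsTowerContinuous χ)
    (hχ : ∀ x y, χ (x * y) = χ x * χ y) (h1 : χ 1 = 1) (hne : χ (σ c) ≠ (Nm c : ℂ_[p])) :
    E.integral χ = (χ (σ c) - (Nm c : ℂ_[p]))⁻¹ *
      ∑ c' ∈ (𝒰 M).cells 0, (D M (((𝒰 M).repr 0 c')⁻¹ • β M c)).integral
        (fun y ↦ (if (𝒰 M).proj 0 y = 1 then (1 : ℂ_[p]) else 0) * χ ((𝒰 M).repr 0 c' * y)) := by
  rw [integral_eq_of_glue (p := p) (href := href) (fun m b ↦ induce (D m) hC0 (hCb m) b) β σ Nm E c hE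
      hC0 (fun _ ↦ le_rfl) hcompat (SubgroupTower.IsTowerContinuous.diagonal_of href hχc) hχ h1 hne,
    integral_glue_eq (href := href) _ hC0 (fun _ ↦ le_rfl) hcompat M hχc,
    integral_induce (D M) hC0 (hCb M) (β M c) hχc]

/-- **Coset reduction, multiplicative form**: with `‖χ‖ ≤ 1` the representative values come out of the inner
integrals: `∫_G χ dE = (χ(σ_𝔠) − N𝔠)⁻¹ · Σ_c χ(r_c) · ∫ 𝟙_{U₀^{(M)}}·χ dD_M(r_c⁻¹•β_M 𝔠)` — literally
de Shalit's (38) line 1 with `=` for `≡`. [cite: deShalit1987, II.4.14 (38) (p. 72), II.4.7 (16) (p. 60)] -/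
theorem integral_eq_cosetSum_mul_of_glue_induce
    (D : (m : ℕ) → B m → GroupDistribution (𝒰 m) ℂ_[p]) {C : ℝ} (hC0 : 0 ≤ C)
    (hCb : ∀ (m : ℕ) (b : B m), (D m b).bound ≤ C)
    (β : (m : ℕ) → I → B m) (σ : I → G) (Nm : I → ℕ)
    (E : GroupDistribution (SubgroupTower.diagonal 𝒰 href) ℂ_[p]) (c : I)
    (hE : ∀ (n : ℕ) (b : G ⧸ (𝒰 n).U n),
      (twisting (σ c) (Nm c : ℂ_[p]) E).μ n b = (induce (D n) hC0 (hCb n) (β n c)).μ n b)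
    (hcompat : ∀ (m n : ℕ) (a : G ⧸ (𝒰 m).U n),
      ((induce (D (m + 1)) hC0 (hCb (m + 1)) (β (m + 1) c)).pushforward (MonoidHom.id G)
        (SubgroupTower.le_comap_id 𝒰 href m)).μ n a = (induce (D m) hC0 (hCb m) (β m c)).μ n a)
    (M : ℕ) {χ : G → ℂ_[p]} (hχc : (𝒰 M).IsTowerContinuous χ) (hχ1 : ∀ x, ‖χ x‖ ≤ 1)
    (hχ : ∀ x y, χ (x * y) = χ x * χ y) (h1 : χ 1 = 1) (hne : χ (σ c) ≠ (Nm c : ℂ_[p])) :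
    E.integral χ = (χ (σ c) - (Nm c : ℂ_[p]))⁻¹ *
      ∑ c' ∈ (𝒰 M).cells 0, χ ((𝒰 M).repr 0 c') * (D M (((𝒰 M).repr 0 c')⁻¹ • β M c)).integral
        (fun y ↦ (if (𝒰 M).proj 0 y = 1 then (1 : ℂ_[p]) else 0) * χ y) := by
  rw [integral_eq_cosetSum_of_glue_induce D hC0 hCb β σ Nm E c hE hcompat M hχc hχ h1 hne]
  congr 1
  refine Finset.sum_congr rfl fun c' _ ↦ ?_
  have hind : (𝒰 M).IsTowerContinuous (fun y ↦ (if (𝒰 M).proj 0 y = 1 then (1 : ℂ_[p]) else 0) * χ y) :=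
    (SubgroupTower.IsTowerContinuous.of_factorsThrough (m := 0)
      (fun b ↦ if b = 1 then (1 : ℂ_[p]) else 0) (fun _ ↦ rfl)).mul hχc (M := 1)
      (fun y ↦ by split_ifs <;> simp) hχ1
  rw [← integral_const_mul _ _ hind]
  refine integral_congr _ fun y ↦ ?_
  rw [hχ, mul_left_comm]

end CosetReduction

/-! ### §3. (38) line 2, measure half: `𝟙_{U₀}`-weighted integrals of integrands agreeing on `U₀` -/

section Indicator

open GroupDistribution

variable {G : Type*} [Group G] {𝒰 : SubgroupTower G} [∀ n, (𝒰.U n).Normal] {𝕜 : Type*} [NormedField 𝕜]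
  [IsUltrametricDist 𝕜] [CompleteSpace 𝕜]

/-- **(38) line 2, measure-theoretic half (generic)**: if `f` and `g` (both of norm `≤ 1`,
tower-continuous) agree to within `η` ON `U₀`, then `∫ 𝟙_{U₀} f dD` and `∫ 𝟙_{U₀} g dD` agree to within
`‖D‖·η` — the passage from the avatar `χφ^kφ̄^j|_{G_n}` to the one-variable monomial `φ^k|_{G_n}` in (38)
line 2 once the ARITHMETIC half (`φ̄^j χ ≡ const` on `Gal(K̄/K(𝔤𝔭̄^{M+1}))` modulo `p^{M+1}`) is supplied.
[cite: deShalit1987, II.4.14 (38) (p. 72), I.3.1 (p. 16)] -/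
theorem norm_integral_indicator_mul_sub_le (D : GroupDistribution 𝒰 𝕜) {f g : G → 𝕜}
    (hf : 𝒰.IsTowerContinuous f) (hg : 𝒰.IsTowerContinuous g)
    (hf1 : ∀ x, ‖f x‖ ≤ 1) (hg1 : ∀ x, ‖g x‖ ≤ 1) {η : ℝ} (hη : 0 ≤ η)
    (hfg : ∀ x, 𝒰.proj 0 x = 1 → ‖f x - g x‖ ≤ η) :
    ‖D.integral (fun x ↦ (if 𝒰.proj 0 x = 1 then (1 : 𝕜) else 0) * f x) -
        D.integral (fun x ↦ (if 𝒰.proj 0 x = 1 then (1 : 𝕜) else 0) * g x)‖ ≤ D.bound * η := by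
  have hind : 𝒰.IsTowerContinuous (fun x ↦ (if 𝒰.proj 0 x = 1 then (1 : 𝕜) else 0)) :=
    SubgroupTower.IsTowerContinuous.of_factorsThrough (m := 0) (fun b ↦ if b = 1 then (1 : 𝕜) else 0)
      (fun _ ↦ rfl)
  have hind1 : ∀ x, ‖(if 𝒰.proj 0 x = 1 then (1 : 𝕜) else 0)‖ ≤ 1 := fun x ↦ by split_ifs <;> simp
  have hF := hind.mul hf (M := 1) hind1 hf1
  have hG := hind.mul hg (M := 1) hind1 hg1
  rw [← D.integral_sub hF hG]
  refine D.norm_integral_le (hF.sub hG) hη fun x ↦ ?_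
  by_cases hx : 𝒰.proj 0 x = 1
  · rw [if_pos hx, one_mul, one_mul]; exact hfg x hx
  · rw [if_neg hx, zero_mul, zero_mul, sub_zero, norm_zero]; exact hη

end Indicator

end Literature.NumberTheory.EllipticCurves

end
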